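import Literature.Computability.Complexity.GoldwasserSipserAssembly
import Literature.Computability.Complexity.ArthurMerlinGamesIPProofs
import HarnessLib

/-!
# `IP[k] ⊆ AM` for every constant `k` (discharge of the named fact `IPk_subset_AM`)

Discharge of `Literature.Computability.Complexity.IPk_subset_AM` (`InteractiveProofs.lean`):
Babai–Moran, JCSS 36 (1988), §1.5 (printed p. 258): "Goldwasser and Sipser [GS] state that
`IP(t(n)) ⊆ AM(t(n)+2)`, which, combined with the Collapse Theorem yields the pleasing conclusion
that `AM(t(n)) = IP(t(n))`". For constant `k`: `IP[k] ⊆ AM[k+2]` (Goldwasser–Sipser, PROVED as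
`GoldwasserSipser1986_IPk_subset_AMk_holds` in `GoldwasserSipserAssembly.lean`), `AM[k+2] = AM[2]`
(Collapse Theorem, Thm. 3, `BabaiMoran1988_collapse_holds`) and `AM[2] = BP·NP = AM`
(`AMk_two_eq_AM_holds`); the glue is `IPk_subset_AM_of_GS` (`ArthurMerlinCollapseProofs.lean`).
Also the equality `IPk_eq_AM` (`IP[k] = AM` for constant `k ≥ 2`, BM §1.5), from `IPk_eq_AM_of_GS`
(`ArthurMerlinGamesIPProofs.lean`).

## References

* L. Babai, S. Moran, *Arthur–Merlin games: a randomized proof system, and a hierarchy of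
  complexity classes*, JCSS 36 (1988) 254–276, §1.5 and Thm. 3.
* S. Goldwasser, M. Sipser, *Private coins versus public coins in interactive proof systems*,
  STOC 1986, §4.2 Main Theorem.
* S. Arora, B. Barak, *Computational Complexity: A Modern Approach*, CUP 2009, Thm. 8.12,
  Remark 8.11.
-/

namespace Literature.Computability.Complexity

/-- **`IP[k] ⊆ AM` for every constant `k`** (discharge of `IPk_subset_AM`): Goldwasser–Sipser
`IP[k] ⊆ AM[k+2]`, the Collapse Theorem `AM[k+2] = AM[2]`, and `AM[2] = BP·NP`.
[cite: BabaiMoran1988, §1.5 and Thm. 3] [cite: GoldwasserSipser1986, §4.2 Main Theorem]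
[cite: AroraBarakCC2009, Thm. 8.12 and Remark 8.11] -/
theorem IPk_subset_AM_holds : IPk_subset_AM :=
  IPk_subset_AM_of_GS GoldwasserSipser1986_IPk_subset_AMk_holds

/-- **`IP[k] = AM` for every constant `k ≥ 2`** ("`AM(t(n)) = IP(t(n))`", the constant case):
`IP[k] ⊆ AM` above, and `AM = AM(k) ⊆ IP(k)` (`AMk_subset_IPk_holds`, Collapse Theorem).
[cite: BabaiMoran1988, §1.5 and Thm. 3] -/
theorem IPk_eq_AM {k : ℕ} (hk : 2 ≤ k) : IPk k = AM :=
  IPk_eq_AM_of_GS GoldwasserSipser1986_IPk_subset_AMk_holds hk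

end Literature.Computability.Complexity
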